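import Mathlib
import Literature.Computability.AlgebraicComplexity.MS21SigmaPiAffStrictWitness
import Literature.Computability.AlgebraicComplexity.VPDeterminantalQPProofs
import HarnessLib

/-!
# Medini–Shpilka 2021, Thm 42 (strictness `ΣΠ^{GLaff} ⊊ ΣΠΣ`), part 2: the separation for
# `char F ≠ 2` by the SHIFT-SPAN count

Sequel of `MS21SigmaPiAffStrictWitness.lean` (witness `W_{n,k} = e_k(x_1², …, x_n²) ∈ ΣΠΣ`). Towards the
named fact `MS2021_thm_42_strict` (`∀ infinite F, ΣΠ^{GLaff}(F) ≠ ΣΠΣ(F)`; CCC 2021 LIPIcs 200:19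
Thm 42 = arXiv:2102.05632 Thm 1.26, p0008:L70-L72) — here the slice **`char F ≠ 2`**
(`sigmaPiAffClass_ne_spsClass_of_ringChar_ne_two`, `…_of_charZero`). PARTIAL RANGE, disclosed:
characteristic `2` is NOT covered (the witness is a square there); the named fact is NOT discharged.

The printed proof (§6, p0034:L10-L26) separates with `σ_d` and Nisan–Wigderson's partial-derivative
rank bound. Disclosed deviation — a derivative-free measure that needs no rank theorem for
set-disjointness matrices: the **shift span** `T(f) = span{f(x + c) : c ∈ Fⁿ}`.
* Upper bound (`card_le_card_support_mul_two_pow`): for `f = g(Ax + b)` (ANY affine substitution,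
  invertibility not used) `f(x + c) = (g(y + Ac))(Ax + b)` (`aeval_X_add_C_affSubst`), and every
  shift of `g` is supported on the down-closure of `supp g` (`support_aeval_X_add_C_subset`), a set of
  at most `∑_α ∏_i (α_i + 1) ≤ #supp(g) · 2^{deg g}` exponents; so at most that many shifts of `f`
  are linearly independent (`restrictSupport`, `finrank_span_eq_card`).
* Lower bound (`linearIndependent_shift_witness`): the `C(n,k)` shifts `W_{n,k}(x + 1_S)`, `|S| = k`,
  are linearly independent when `2 ≠ 0`: the coefficient of `∏_{i∈S₀} x_i` in `W_{n,k}(x + 1_S)` is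
  `2^k · [S = S₀]` (the summand `T = S` is `∏_{i∈S}(x_i + 1)²`; every other summand is a multiple of
  some `x_j²`).
* Growth (`exists_lt_of_isPBounded`, `pow_le_choose_of_le`): with `k = n/36`, `C(n,k) ≥ 35^k` beats
  `m(n) · 4^k` for any p-bounded sparsity `m` at `n = 36 · 2^{2A+14}`.

Theorem-only file (no definitions, no new named fact); `VP ≠ VNP` is NOT proved and nothing here bears
on it.

## References
* [MediniShpilka2021] D. Medini, A. Shpilka, CCC 2021, LIPIcs 200:19, Thm 42 (= arXiv:2102.05632
  Thm 1.26, p0008:L70-L72; proof §6, p0034:L10-L26, incl. Claim 6.1).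
* N. Nisan, A. Wigderson, *Lower bounds on arithmetic circuits via partial derivatives*, Comput.
  Complexity 6 (1996), Thm 0 (the printed route, NOT formalised here).
-/

noncomputable section

open MvPolynomial Matrix

namespace Literature.Computability.AlgebraicComplexity

namespace MS2021

namespace Thm42Strict

variable {K : Type*} [Field K]

/-! ### Shifts of an affine substitution are affine substitutions of shifts -/

/-- `(g(Ax+b))(x + c) = (g(y + A c))(Ax + b)`: a shift of `f = g(Ax+b)` is the same affine substitution
applied to a shift of `g` (no invertibility of `A` needed).
[cite: MediniShpilka2021, §1.1.6 eq. (2) and §6 Claim 6.1 (arXiv p0034:L12-L18)] -/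
theorem aeval_X_add_C_affSubst {m n : ℕ} (h : m ≤ n) (A : Matrix (Fin n) (Fin n) K)
    (b c : Fin n → K) (g : MvPolynomial (Fin m) K) :
    aeval (fun j : Fin n => (X j : MvPolynomial (Fin n) K) + C (c j)) (affSubst h A b g) =
      affSubst h A b
        (aeval (fun i : Fin m => (X i : MvPolynomial (Fin m) K) + C ((A *ᵥ c) (Fin.castLE h i))) g) := by
  unfold affSubst
  rw [comp_aeval_apply, comp_aeval_apply]
  have key : (fun i : Fin m => (aeval fun j : Fin n => (X j : MvPolynomial (Fin n) K) + C (c j))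
        ((∑ j : Fin n, C (A (Fin.castLE h i) j) * X j) + C (b (Fin.castLE h i)))) =
      fun i : Fin m => (aeval fun i' : Fin m =>
        (∑ j : Fin n, C (A (Fin.castLE h i') j) * X j) + C (b (Fin.castLE h i')))
          ((X i : MvPolynomial (Fin m) K) + C ((A *ᵥ c) (Fin.castLE h i))) := by
    funext i
    simp only [map_add, map_sum, map_mul, aeval_C, aeval_X, algebraMap_eq, Matrix.mulVec,
      dotProduct, mul_add, Finset.sum_add_distrib]
    ring
  rw [key]

/-! ### The shifts of a sparse polynomial live on the down-closure of its support -/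

/-- Every monomial of `g(x + d)` lies below some monomial of `g`. [folklore] -/
private theorem support_aeval_X_add_C_subset {m : ℕ} (g : MvPolynomial (Fin m) K) (d : Fin m → K) :
    (↑(aeval (fun i : Fin m => (X i : MvPolynomial (Fin m) K) + C (d i)) g).support :
        Set (Fin m →₀ ℕ)) ⊆ ↑(g.support.biUnion fun α => Finset.Iic α) := by
  classical
  intro γ hγ
  rw [Finset.mem_coe] at hγ ⊢
  rw [MvPolynomial.aeval_def, MvPolynomial.eval₂_eq, algebraMap_eq] at hγ
  obtain ⟨α, hα, hγα⟩ := Finset.mem_biUnion.mp (support_sum hγ)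
  refine Finset.mem_biUnion.mpr ⟨α, hα, Finset.mem_Iic.mpr ?_⟩
  have hγ' : γ ∈ (∏ i ∈ α.support,
      ((X i : MvPolynomial (Fin m) K) + C (d i)) ^ α i).support := by
    rw [C_mul'] at hγα
    exact support_smul hγα
  have hdeg : ∀ i j : Fin m,
      degreeOf i (((X j : MvPolynomial (Fin m) K) + C (d j))) ≤ if i = j then 1 else 0 := by
    intro i j
    refine (degreeOf_add_le _ _ _).trans ?_
    rw [degreeOf_X, degreeOf_C]
    simp
  refine Finsupp.le_def.mpr fun i => ?_
  calc γ i ≤ degreeOf i (∏ j ∈ α.support, ((X j : MvPolynomial (Fin m) K) + C (d j)) ^ α j) :=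
        monomial_le_degreeOf i hγ'
    _ ≤ ∑ j ∈ α.support, degreeOf i (((X j : MvPolynomial (Fin m) K) + C (d j)) ^ α j) :=
        degreeOf_prod_le _ _ _
    _ ≤ ∑ j ∈ α.support, α j * (if i = j then 1 else 0) :=
        Finset.sum_le_sum fun j _ => (degreeOf_pow_le _ _ _).trans (Nat.mul_le_mul_left _ (hdeg i j))
    _ ≤ α i := by
        simp_rw [mul_ite, mul_one, mul_zero]
        rw [Finset.sum_ite_eq]
        split_ifs
        · exact le_rfl
        · exact Nat.zero_le _

/-- `#{γ ≤ α} = ∏_i (α_i + 1) ≤ 2^{|α|}`. [folklore] -/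
private theorem card_Iic_le_two_pow {m : ℕ} (α : Fin m →₀ ℕ) :
    (Finset.Iic α).card ≤ 2 ^ (α.sum fun _ e => e) := by
  classical
  rw [Finsupp.card_Iic]
  calc ∏ i ∈ α.support, (Finset.Iic (α i)).card = ∏ i ∈ α.support, (α i + 1) := by
        simp [Nat.card_Iic]
    _ ≤ ∏ i ∈ α.support, 2 ^ (α i) :=
        Finset.prod_le_prod' fun i _ => Nat.lt_two_pow_self
    _ = 2 ^ (∑ i ∈ α.support, α i) := Finset.prod_pow_eq_pow_sum _ _ _
    _ = 2 ^ (α.sum fun _ e => e) := rfl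

/-- **The shift-span bound.** If `C(ι)`-many shifts `f(x + c_s)` of `f = g(Ax+b)` are linearly independent
and `deg g ≤ D`, then `|ι| ≤ #supp(g) · 2^D`: all shifts lie in the image under `p ↦ p(Ax+b)` of the
span of the monomials below the support of `g`. [cite: MediniShpilka2021, §6 (sparsity of ΣΠ^{GLaff} members; arXiv p0034:L20-L24)] -/
theorem card_le_card_support_mul_two_pow {m n D : ℕ} {ι : Type*} [Fintype ι] (h : m ≤ n)
    (A : Matrix (Fin n) (Fin n) K) (b : Fin n → K) (g : MvPolynomial (Fin m) K)
    (hD : g.totalDegree ≤ D) (c : ι → Fin n → K)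
    (hli : LinearIndependent K fun s : ι =>
      aeval (fun j : Fin n => (X j : MvPolynomial (Fin n) K) + C (c s j)) (affSubst h A b g)) :
    Fintype.card ι ≤ g.support.card * 2 ^ D := by
  classical
  set Dset : Finset (Fin m →₀ ℕ) := g.support.biUnion fun α => Finset.Iic α with hDset
  set R : Submodule K (MvPolynomial (Fin m) K) :=
    restrictSupport K (↑Dset : Set (Fin m →₀ ℕ)) with hR
  haveI : Module.Finite K R :=
    Module.Finite.of_basis (basisRestrictSupport K (↑Dset : Set (Fin m →₀ ℕ)))
  set φ : MvPolynomial (Fin m) K →ₗ[K] MvPolynomial (Fin n) K :=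
    (aeval (fun i : Fin m => (∑ j : Fin n, C (A (Fin.castLE h i) j) * X j) +
      C (b (Fin.castLE h i)))).toLinearMap with hφ
  have hmem : ∀ s : ι,
      aeval (fun j : Fin n => (X j : MvPolynomial (Fin n) K) + C (c s j)) (affSubst h A b g) ∈
        R.map φ := by
    intro s
    rw [aeval_X_add_C_affSubst]
    exact Submodule.mem_map.mpr
      ⟨_, (mem_restrictSupport_iff K).mpr (support_aeval_X_add_C_subset g _), rfl⟩
  have hspan : Submodule.span K (Set.range fun s : ι =>
      aeval (fun j : Fin n => (X j : MvPolynomial (Fin n) K) + C (c s j)) (affSubst h A b g)) ≤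
        R.map φ :=
    Submodule.span_le.mpr (Set.range_subset_iff.mpr hmem)
  have hcard : Module.finrank K R = Dset.card := by
    rw [Module.finrank_eq_card_basis (basisRestrictSupport K (↑Dset : Set (Fin m →₀ ℕ)))]
    simp
  calc Fintype.card ι = Module.finrank K (Submodule.span K (Set.range fun s : ι =>
        aeval (fun j : Fin n => (X j : MvPolynomial (Fin n) K) + C (c s j)) (affSubst h A b g))) :=
        (finrank_span_eq_card hli).symm
    _ ≤ Module.finrank K (R.map φ) := Submodule.finrank_mono hspan
    _ ≤ Module.finrank K R := Submodule.finrank_map_le φ R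
    _ = Dset.card := hcard
    _ ≤ ∑ α ∈ g.support, (Finset.Iic α).card := Finset.card_biUnion_le
    _ ≤ ∑ α ∈ g.support, 2 ^ D := Finset.sum_le_sum fun α hα =>
        (card_Iic_le_two_pow α).trans
          (Nat.pow_le_pow_right (by norm_num) ((le_totalDegree hα).trans hD))
    _ = g.support.card * 2 ^ D := by rw [Finset.sum_const, smul_eq_mul]

/-! ### Shifts of the witness by indicator vectors are linearly independent (`char ≠ 2`) -/

/-- The indicator exponent vector `1_S` evaluated at `j`. [folklore] -/
private theorem indicator_apply {n : ℕ} (S : Finset (Fin n)) (j : Fin n) :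
    (∑ i ∈ S, Finsupp.single i (1 : ℕ)) j = if j ∈ S then 1 else 0 := by
  classical
  rw [Finsupp.finsetSum_apply]
  simp_rw [Finsupp.single_apply]
  rw [Finset.sum_ite_eq' S j]

/-- A squarefree coefficient of a multiple of `x_j²` vanishes. [folklore] -/
private theorem coeff_X_sq_mul_eq_zero {n : ℕ} (j : Fin n) (Q : MvPolynomial (Fin n) K) (m : Fin n →₀ ℕ)
    (hm : m j ≤ 1) : coeff m ((X j : MvPolynomial (Fin n) K) ^ 2 * Q) = 0 := by
  classical
  rw [X_pow_eq_monomial, coeff_monomial_mul', if_neg]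
  intro hle
  have := hle j
  rw [Finsupp.single_eq_same] at this
  omega

/-- `∏_{i ∈ S} (x_i + 1)²` does not involve `x_a` for `a ∉ S`. [folklore] -/
private theorem degreeOf_prod_X_add_one_sq_eq_zero {n : ℕ} (S : Finset (Fin n)) (a : Fin n) (ha : a ∉ S) :
    degreeOf a (∏ i ∈ S, ((X i : MvPolynomial (Fin n) K) + C 1) ^ 2) = 0 := by
  classical
  apply Nat.eq_zero_of_le_zero
  refine (degreeOf_prod_le _ _ _).trans (le_of_eq (Finset.sum_eq_zero fun i hi => ?_))
  apply Nat.eq_zero_of_le_zero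
  refine (degreeOf_pow_le _ _ _).trans ?_
  have h0 : degreeOf a ((X i : MvPolynomial (Fin n) K) + C 1) = 0 := by
    apply Nat.eq_zero_of_le_zero
    refine (degreeOf_add_le _ _ _).trans ?_
    have hai : a ≠ i := fun h => ha (by rw [h]; exact hi)
    rw [degreeOf_X, degreeOf_C, if_neg hai]
    simp
  rw [h0, mul_zero]

/-- The coefficient of `∏_{i ∈ S} x_i` in `∏_{i ∈ S} (x_i + 1)²` is `2^{|S|}`. [folklore] -/
private theorem coeff_indicator_prod_X_add_one_sq {n : ℕ} (S : Finset (Fin n)) :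
    coeff (∑ i ∈ S, Finsupp.single i 1) (∏ i ∈ S, ((X i : MvPolynomial (Fin n) K) + C 1) ^ 2) =
      2 ^ S.card := by
  classical
  induction S using Finset.induction_on with
  | empty => simp
  | insert a S ha ih =>
    rw [Finset.prod_insert ha, Finset.sum_insert ha, Finset.card_insert_of_notMem ha]
    have hexp : ((X a : MvPolynomial (Fin n) K) + C 1) ^ 2 =
        (X a : MvPolynomial (Fin n) K) ^ 2 + (C 2 * X a + 1) := by
      rw [map_one, map_ofNat]; ring
    rw [hexp, add_mul, coeff_add, add_mul, coeff_add, one_mul]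
    -- the `x_a²` part has no squarefree coefficient
    have h1 : coeff (Finsupp.single a 1 + ∑ i ∈ S, Finsupp.single i 1)
        ((X a : MvPolynomial (Fin n) K) ^ 2 * ∏ i ∈ S, ((X i : MvPolynomial (Fin n) K) + C 1) ^ 2) = 0 := by
      refine coeff_X_sq_mul_eq_zero a _ _ ?_
      rw [Finsupp.add_apply, Finsupp.single_eq_same, indicator_apply, if_neg ha]
    -- the linear part shifts the exponent by `e_a`
    have h2 : coeff (Finsupp.single a 1 + ∑ i ∈ S, Finsupp.single i 1)
        (C 2 * (X a : MvPolynomial (Fin n) K) * ∏ i ∈ S, ((X i : MvPolynomial (Fin n) K) + C 1) ^ 2) =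
          2 * 2 ^ S.card := by
      rw [mul_assoc, coeff_C_mul, coeff_X_mul', if_pos, add_tsub_cancel_left, ih]
      rw [Finsupp.mem_support_iff, Finsupp.add_apply, Finsupp.single_eq_same]
      omega
    -- the constant part misses the variable `x_a`
    have h3 : coeff (Finsupp.single a 1 + ∑ i ∈ S, Finsupp.single i 1)
        (∏ i ∈ S, ((X i : MvPolynomial (Fin n) K) + C 1) ^ 2) = 0 := by
      by_contra hne
      have hmem := Finsupp.mem_support_iff.mpr hne
      have hle := monomial_le_degreeOf a hmem
      rw [degreeOf_prod_X_add_one_sq_eq_zero S a ha, Finsupp.add_apply, Finsupp.single_eq_same] at hle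
      omega
    rw [h1, h2, h3, zero_add, add_zero, pow_succ, mul_comm]

/-- Coefficient of `∏_{i∈S₀} x_i` (`|S₀| = |S|`) in `∏_{i ∈ S} (x_i + 1)²`: `2^{|S|}` if `S₀ = S`,
else `0`. [folklore] -/
private theorem coeff_indicator_prod_X_add_one_sq_of_card_eq {n : ℕ} (S S₀ : Finset (Fin n))
    (hcard : S₀.card = S.card) :
    coeff (∑ i ∈ S₀, Finsupp.single i 1) (∏ i ∈ S, ((X i : MvPolynomial (Fin n) K) + C 1) ^ 2) =
      if S₀ = S then 2 ^ S.card else 0 := by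
  classical
  by_cases hS : S₀ = S
  · subst hS
    rw [if_pos rfl, coeff_indicator_prod_X_add_one_sq]
  · rw [if_neg hS]
    -- some `j ∈ S₀ \ S`
    have hnot : ¬ S₀ ⊆ S := fun hsub => hS (Finset.eq_of_subset_of_card_le hsub hcard.ge)
    obtain ⟨j, hjS₀, hjS⟩ := Finset.not_subset.mp hnot
    by_contra hne
    have hmem := Finsupp.mem_support_iff.mpr hne
    have hle := monomial_le_degreeOf j hmem
    rw [degreeOf_prod_X_add_one_sq_eq_zero S j hjS, indicator_apply, if_pos hjS₀] at hle
    omega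

/-- **Coefficient of `∏_{i ∈ S₀} x_i` in the shifted witness `W_{n,k}(x + 1_S)`** (`|S| = |S₀| = k`):
`2^k` if `S = S₀`, else `0` — the summand `T = S` is `∏_{i∈S}(x_i+1)²`, every other summand is a
multiple of some `x_j²`. [cite: MediniShpilka2021, §6 (separation witness bookkeeping; arXiv p0034:L20-L26)] -/
theorem coeff_indicator_shift_witness {n k : ℕ} (S S₀ : Finset (Fin n)) (hS : S.card = k)
    (hS₀ : S₀.card = k) :
    coeff (∑ i ∈ S₀, Finsupp.single i 1)
      (aeval (fun i : Fin n => (X i : MvPolynomial (Fin n) K) + C (if i ∈ S then (1 : K) else 0))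
        (∑ T ∈ (Finset.univ : Finset (Fin n)).powersetCard k,
          ∏ i ∈ T, (X i : MvPolynomial (Fin n) K) ^ 2)) =
      if S₀ = S then (2 : K) ^ k else 0 := by
  classical
  rw [map_sum, coeff_sum]
  simp_rw [map_prod, map_pow, aeval_X]
  rw [Finset.sum_eq_single S]
  · rw [Finset.prod_congr rfl fun i (hi : i ∈ S) => by rw [if_pos hi], ← hS]
    exact coeff_indicator_prod_X_add_one_sq_of_card_eq S S₀ (hS₀.trans hS.symm)
  · intro T hT hTS
    have hTk : T.card = k := (Finset.mem_powersetCard.mp hT).2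
    have hnot : ¬ T ⊆ S := fun hsub =>
      hTS (Finset.eq_of_subset_of_card_le hsub (by rw [hS, hTk]))
    obtain ⟨j, hjT, hjS⟩ := Finset.not_subset.mp hnot
    rw [← Finset.mul_prod_erase T _ hjT, if_neg hjS, map_zero, add_zero]
    refine coeff_X_sq_mul_eq_zero j _ _ ?_
    rw [indicator_apply]
    split_ifs <;> omega
  · intro hS'
    exact absurd (Finset.mem_powersetCard.mpr ⟨Finset.subset_univ S, hS⟩) hS'

/-- **The `C(n,k)` shifts `W_{n,k}(x + 1_S)`, `|S| = k`, are linearly independent when `char K ≠ 2`.**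
[cite: MediniShpilka2021, §6 (separation ΣΠ^{GLaff} ⊊ ΣΠΣ; arXiv p0034:L20-L26)] -/
theorem linearIndependent_shift_witness (h2 : ringChar K ≠ 2) (n k : ℕ) :
    LinearIndependent K fun S : (Finset.univ : Finset (Fin n)).powersetCard k =>
      aeval (fun i : Fin n => (X i : MvPolynomial (Fin n) K) + C (if i ∈ (S : Finset (Fin n)) then
        (1 : K) else 0))
        (∑ T ∈ (Finset.univ : Finset (Fin n)).powersetCard k,
          ∏ i ∈ T, (X i : MvPolynomial (Fin n) K) ^ 2) := by
  classical
  refine linearIndependent_iff'.mpr fun s g hsum S₀ hS₀ => ?_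
  have hk : ∀ S : (Finset.univ : Finset (Fin n)).powersetCard k, (S : Finset (Fin n)).card = k :=
    fun S => (Finset.mem_powersetCard.mp S.2).2
  have h := congr_arg (coeff (∑ i ∈ (S₀ : Finset (Fin n)), Finsupp.single i 1)) hsum
  rw [coeff_sum, coeff_zero] at h
  simp_rw [smul_eq_C_mul, coeff_C_mul] at h
  rw [Finset.sum_eq_single S₀] at h
  · rw [coeff_indicator_shift_witness _ _ (hk S₀) (hk S₀), if_pos rfl] at h
    exact (mul_eq_zero.mp h).resolve_right (pow_ne_zero k (Ring.two_ne_zero h2))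
  · intro S _ hSS₀
    rw [coeff_indicator_shift_witness _ _ (hk S) (hk S₀), if_neg, mul_zero]
    exact fun heq => hSS₀ (Subtype.ext heq.symm)
  · intro hS₀'
    exact absurd hS₀ hS₀'

/-! ### Growth: `35^k ≤ C(36k, k)` and p-bounded functions are eventually below `8^k` -/

/-- `35^j ≤ C(36k, j)` for `j ≤ k`. [folklore] -/
private theorem pow_le_choose_of_le (k : ℕ) : ∀ j : ℕ, j ≤ k → 35 ^ j ≤ Nat.choose (36 * k) j
  | 0, _ => by simp
  | j + 1, hj => by
    have ih := pow_le_choose_of_le k j (Nat.le_of_succ_le hj)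
    have hrec := Nat.choose_succ_right_eq (36 * k) j
    -- `C(36k, j+1) (j+1) = C(36k, j) (36k - j) ≥ 35^j · 35 (j+1)`
    have hge : 35 ^ j * (35 * (j + 1)) ≤ Nat.choose (36 * k) (j + 1) * (j + 1) := by
      rw [hrec]
      exact Nat.mul_le_mul ih (by omega)
    have : 35 ^ (j + 1) * (j + 1) ≤ Nat.choose (36 * k) (j + 1) * (j + 1) := by
      calc 35 ^ (j + 1) * (j + 1) = 35 ^ j * (35 * (j + 1)) := by ring
        _ ≤ _ := hge
    exact Nat.le_of_mul_le_mul_right this (Nat.succ_pos j)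

/-- A p-bounded function is eventually (at `n = 36 · 2^j` for a suitable `j`) below `8^{n/36}`:
concretely `m(36k) · 4^k < 35^k` with `k = 2^{2A+14}`. [folklore] -/
private theorem exists_lt_of_isPBounded {m : ℕ → ℕ} (hm : IsPBounded m) :
    ∃ k : ℕ, 1 ≤ k ∧ m (36 * k) * 4 ^ k < 35 ^ k := by
  obtain ⟨A, hA1, hA⟩ := IsPBounded.exists_lt_two_pow hm
  have hA2 : A < 2 ^ A := Nat.lt_two_pow_self
  refine ⟨2 ^ (2 * A + 14), Nat.one_le_two_pow, ?_⟩
  -- `log₂ (36 · 2^(2A+14)) + 1 ≤ 2A + 20`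
  have hlog : Nat.log 2 (36 * 2 ^ (2 * A + 14)) + 1 ≤ 2 * A + 20 := by
    have hlt : 36 * 2 ^ (2 * A + 14) < 2 ^ (2 * A + 20) := by
      have h64 : (2 : ℕ) ^ (2 * A + 20) = 2 ^ (2 * A + 14) * 64 := by
        rw [show 2 * A + 20 = (2 * A + 14) + 6 by ring, pow_add]; norm_num
      have hpos : 0 < 2 ^ (2 * A + 14) := by positivity
      rw [h64]; omega
    have := Nat.log_lt_of_lt_pow (by positivity) hlt
    omega
  -- `(2A + 20) · A ≤ 3 · 2^(2A+14)`
  have hjA : (2 * A + 20) * A ≤ 3 * 2 ^ (2 * A + 14) := by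
    have h1 : 2 * A + 20 ≤ 2 ^ (A + 5) := by
      have h32 : (2 : ℕ) ^ (A + 5) = 32 * 2 ^ A := by rw [pow_add]; norm_num; ring
      rw [h32]
      calc 2 * A + 20 ≤ 32 * (A + 1) := by omega
        _ ≤ 32 * 2 ^ A := Nat.mul_le_mul_left 32 hA2
    calc (2 * A + 20) * A ≤ 2 ^ (A + 5) * 2 ^ A := Nat.mul_le_mul h1 hA2.le
      _ = 2 ^ (2 * A + 5) := by rw [← pow_add]; ring_nf
      _ ≤ 2 ^ (2 * A + 14) := Nat.pow_le_pow_right (by norm_num) (by omega)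
      _ ≤ 3 * 2 ^ (2 * A + 14) := by omega
  have hm' : m (36 * 2 ^ (2 * A + 14)) < 2 ^ (3 * 2 ^ (2 * A + 14)) :=
    (hA _).trans_le (Nat.pow_le_pow_right (by norm_num)
      ((Nat.mul_le_mul_right A hlog).trans hjA))
  calc m (36 * 2 ^ (2 * A + 14)) * 4 ^ 2 ^ (2 * A + 14)
      < 2 ^ (3 * 2 ^ (2 * A + 14)) * 4 ^ 2 ^ (2 * A + 14) :=
        mul_lt_mul_of_pos_right hm' (by positivity)
    _ = 32 ^ 2 ^ (2 * A + 14) := by rw [pow_mul, ← mul_pow]; norm_num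
    _ ≤ 35 ^ 2 ^ (2 * A + 14) := Nat.pow_le_pow_left (by norm_num) _

/-! ### The separation for `char K ≠ 2` -/

/-- **Medini–Shpilka Thm 42, strictness `ΣΠ^{GLaff}(F) ⊊ ΣΠΣ(F)` — the slice `char F ≠ 2`.**
For every infinite field `F` with `char F ≠ 2` the classes differ: the family `e_{n/36}(x_1²,…,x_n²)`
is in `ΣΠΣ(F)` (`isSPS_witness`) but not in `ΣΠ^{GLaff}(F)` (shift-span count). PARTIAL RANGE: the
typed fact `MS2021_thm_42_strict` quantifies over ALL infinite fields; characteristic `2` is NOT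
covered here (the witness is a square there) and the named fact stays undischarged.
[cite: MediniShpilka2021, Thm 42 (CCC 2021 LIPIcs 200:19 p.19:14; = arXiv:2102.05632 Thm 1.26 p0008:L70-L72; proof §6 p0034:L10-L26)] -/
theorem sigmaPiAffClass_ne_spsClass_of_ringChar_ne_two (K : Type) [Field K] [Infinite K]
    (h2 : ringChar K ≠ 2) : SigmaPiAffClass K ≠ SPSClass K := by
  classical
  intro heq
  -- the witness family is in `ΣΠΣ`
  have hW : (fun n => ∑ T ∈ (Finset.univ : Finset (Fin n)).powersetCard (n / 36),
      ∏ i ∈ T, (X i : MvPolynomial (Fin n) K) ^ 2) ∈ SPSClass K := by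
    refine ⟨fun n => n + 1, fun n => n + n + 1,
      IsPBounded.add_holds IsPBounded.id (IsPBounded.const 1),
      IsPBounded.add_holds (IsPBounded.add_holds IsPBounded.id IsPBounded.id) (IsPBounded.const 1),
      fun n => isSPS_witness (Nat.div_le_self n 36)⟩
  rw [← heq] at hW
  obtain ⟨-, m, hm, hmem⟩ := hW
  obtain ⟨k, hk1, hlt⟩ := exists_lt_of_isPBounded hm
  obtain ⟨m', g, hm'n, hsupp, hdeg, hle, A, b, hA, hWg⟩ := hmem (36 * k)
  have hkdiv : 36 * k / 36 = k := by omega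
  dsimp only at hdeg hWg
  rw [hkdiv] at hdeg hWg
  -- the shifts of the witness by indicator vectors are affine substitutions of shifts of `g`
  have hli := linearIndependent_shift_witness (K := K) h2 (36 * k) k
  rw [hWg] at hli
  have hcard := card_le_card_support_mul_two_pow hle A b g
    (hdeg.trans totalDegree_witness_le) _ hli
  rw [Fintype.card_coe, Finset.card_powersetCard, Finset.card_univ, Fintype.card_fin] at hcard
  -- `35^k ≤ C(36k, k) ≤ #supp g · 4^k ≤ m(36k) · 4^k < 35^k`
  have h35 := pow_le_choose_of_le k k le_rfl
  have h4 : (2 : ℕ) ^ (2 * k) = 4 ^ k := by rw [pow_mul]; norm_num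
  rw [h4] at hcard
  have hfin := (h35.trans hcard).trans (Nat.mul_le_mul_right _ hsupp)
  exact absurd (lt_of_le_of_lt hfin hlt) (lt_irrefl _)

/-- The characteristic-zero case. [cite: MediniShpilka2021, Thm 42 (CCC 2021 LIPIcs 200:19 p.19:14; = arXiv:2102.05632 Thm 1.26)] -/
theorem sigmaPiAffClass_ne_spsClass_of_charZero (K : Type) [Field K] [CharZero K] :
    SigmaPiAffClass K ≠ SPSClass K :=
  haveI : Infinite K := Infinite.of_injective _ Nat.cast_injective
  sigmaPiAffClass_ne_spsClass_of_ringChar_ne_two K (by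
    rw [ringChar.eq_zero]; norm_num)

end Thm42Strict

end MS2021

end Literature.Computability.AlgebraicComplexity

end
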